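import Literature.AlgebraicGeometry.Resolution.ArithmeticalThreefoldsLocalOfGeneral
import Summits.ResolutionOfSingularities.ResolutionOfSingularities.Theorems.RadicialJungCleanModelsStubCossartPiltant2019PushDownOfGeneral
import Summits.ResolutionOfSingularities.ResolutionOfSingularities.Theorems.RadicialJungCleanModelsStubCjs2020Thm14OfHistory
import Summits.ResolutionOfSingularities.ResolutionOfSingularities.Theorems.RadicialJungCleanModelsOfInputs
import Literature.AlgebraicGeometry.Resolution.ResolutionOfSingularitiesProofs
import HarnessLib

/-!
# `CleanModels` BY NAME from {F-72, CP 2019 Thm. 1.1 as printed, F-112, wi-91399, (B), X44c, frontier}; and the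
# paper-architecture chain of stub 2 at characteristic `p` run on {F-72, Thm. 1.1} alone

OURS (decomp-res hand-1 g21; crux `stmt-ResolutionOfSingularities-15917`, skeleton rev 35).  Closing bookkeeping of this
generation's kernel edges: F-32 ⟸ F-72 (`CossartJannsenSaito2020Embedded.of_canonicalSequence_history`), and every named leaf of
stub 2's paper-architecture DAG at characteristic `p` other than the CJS input — CP Thm. 1.5 (`CossartPiltant2019Local`), [CoP1]
Lemma 9.4 Kummer core, [CoP1] Prop. 9.3 — ⟸ `CossartPiltant2019General` (CP Thm. 1.1 as printed;
`CossartPiltant2019General.cossartPiltant2019Local`, `lemma94KummerCore_of_general`, `prop93_of_general`).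

* `resolutionOverUpToDim_three_of_history_of_general_charP` / `localUniformization3_of_history_of_general_charP` — the
  characteristic-`p` slice of stub 2 ALONG THE PAPER'S ARCHITECTURE (`…_of_history_of_lemma94_of_prop93_charP`) with every leaf
  supplied from {F-72, Thm. 1.1}: a kernel certificate that the chain hides no further assumption;
* `OfInputs.cleanModels_of_history_of_general` — the crux BY NAME from F-72, `CossartPiltant2019General`, F-112 `Cossart1987Thm`,
  wi-91399 `CossartPiltant2019_thm_1_5_i_baseSidePhase`, and the three research/frontier stubs 5–7 VERBATIM (twin of
  `OfInputs.cleanModels_of_namedPrintedLeaves` with {F-32, Thm 1.5, Lemma 9.4, Prop 9.3, Hironaka} replaced by {F-72, Thm 1.1}).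

Reading of the crux's printed trust base after hand-1 g21: {F-72 (CJS 2020 Cor. 6.26 construction), CP 2019 Thm. 1.1 (or verbatim
`CP2019.CossartPiltant2019Thm11` via `.general`), Cossart 1987 (`k = k̄` classes), CP 2019 Thm. 1.5 (i) base side at `p = 2`} + research
stubs 5–6 + frontier stub 7.  CONDITIONAL packaging; nothing here proves resolution in characteristic `p`; rung 0.  AI-written; AI review
weaker than expert review.
-/

noncomputable section

-- `Summit.ResolutionOfSingularities.ResolutionOfSingularities` (summit = problem) duplicates a namespace component by design (D-0017).
set_option linter.dupNamespace false

open CategoryTheory AlgebraicGeometry IsLocalRing Polynomial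
open Literature.AlgebraicGeometry.Resolution Literature.AlgebraicGeometry.Motives
open Literature.AlgebraicGeometry.CossartPiltant200819
open _root_.IntermediateField

namespace Summit.ResolutionOfSingularities.ResolutionOfSingularities.Theorems.RadicialJung.CleanModels

/-- **Resolution up to dimension three at characteristic `p` along the paper's architecture, all leaves from {F-72, Thm. 1.1}**:
`resolutionOverUpToDim_three_of_history_of_lemma94_of_prop93_charP` with CP Thm. 1.5 := `CossartPiltant2019General.cossartPiltant2019Local`,
Lemma 9.4 := `lemma94KummerCore_of_general`, Prop. 9.3 := `prop93_of_general`.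
[cite: CossartPiltant2019, Thm. 1.1, Thm. 1.5, Props. 4.4, 4.6, 4.8, 4.10] [cite: CossartPiltant2008, Lemma 9.4, Prop. 9.3]
[cite: CossartJannsenSaito2020, Thm. 1.4, Cor. 6.26] -/
theorem resolutionOverUpToDim_three_of_history_of_general_charP (p : ℕ) (hp : p.Prime)
    (h72 : CossartJannsenSaito2020_canonicalSequence_history.{0}) (hG : CossartPiltant2019General.{0})
    (k : Type) [Field k] [CharP k p] : ResolutionOverUpToDim.{0} k 3 :=
  resolutionOverUpToDim_three_of_history_of_lemma94_of_prop93_charP p hp hG.cossartPiltant2019Local h72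
    (lemma94KummerCore_of_general hG) (prop93_of_general hG) k

/-- **Local uniformization in dimension three at characteristic `p`, same inputs.**
[cite: CossartPiltant2019, Thm. 1.1, Thm. 1.5, Props. 4.4, 4.6, 4.8, 4.10] [cite: CossartPiltant2008, Lemma 9.4, Prop. 9.3]
[cite: CossartJannsenSaito2020, Thm. 1.4, Cor. 6.26] -/
theorem localUniformization3_of_history_of_general_charP (p : ℕ) (hp : p.Prime)
    (h72 : CossartJannsenSaito2020_canonicalSequence_history.{0}) (hG : CossartPiltant2019General.{0})
    (k : Type) [Field k] [CharP k p] : LocalUniformization3 k :=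
  localUniformization3_of_history_of_lemma94_of_prop93_charP p hp hG.cossartPiltant2019Local h72
    (lemma94KummerCore_of_general hG) (prop93_of_general hG) k

namespace OfInputs

/-- **`CleanModels` BY NAME from {F-72, CP 2019 Thm. 1.1 as printed, F-112, wi-91399, (B), X44c, frontier}** —
`cleanModels_of_inputs` with F-32 := `CossartJannsenSaito2020Embedded.of_canonicalSequence_history h72` and F-02 :=
`CossartPiltant2019General.cossartPiltant2019' hG`. [cite: CossartJannsenSaito2020, Thm. 1.4, Cor. 6.26] [cite: CossartPiltant2019, Thm. 1.1, Thm. 1.5]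
[cite: Cossart1987, main theorem] [cite: Posva2024, App. A] -/
theorem cleanModels_of_history_of_general
  -- PRINTED CONSTRUCTION F-72: Cossart–Jannsen–Saito 2020, Cor. 6.26 / Thm. 6.9 (a). [cite: CossartJannsenSaito2020, Cor. 6.26]
  (h72 : CossartJannsenSaito2020_canonicalSequence_history.{0})
  -- PRINTED: Cossart–Piltant 2019 Thm. 1.1 (quasi-excellent, dim ≤ 3). [cite: CossartPiltant2019, Thm. 1.1]
  (hG : CossartPiltant2019General.{0})
  -- PRINTED F-112: Cossart 1987 (`k = k̄`). [cite: Cossart1987, main theorem; Posva2024, App. A]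
  (h112 : Cossart1987Thm)
  -- PRINTED wi-91399: Cossart–Piltant 2019 Thm. 1.5 (i), base-side `m = p` phase (every `p`; consumed at `p = 2`).
  (hBS : CossartPiltant2019_thm_1_5_i_baseSidePhase.{0})
  -- RESEARCH (OURS), class (B): `stub_cleanLU3DefectNonDiscrete` of Sketch rev 33, VERBATIM.
  (hB :
    ∀ (p : ℕ), p.Prime → p ≠ 2 →
    ∀ (k : Type) [Field k] [CharP k p] (K : Type) [Field K] [Algebra k K]
    (O : ValuationSubring K) (A : Subalgebra k K), A.toSubring ≤ O.toSubring → A.FG → IsFractionRing A K →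
    ringKrullDim A ≤ 3 → IsRegularLocalRing (locAtCentre A.toSubring O) →
    ringKrullDim (locAtCentre A.toSubring O) = 3 →
    (∀ (T : Subring K) (hT : T ≤ O.toSubring), A.toSubring ≤ T → (subringCentre T O hT).IsMaximal) →
    ∀ g₀ : K, (∀ c : K, c ^ p ≠ g₀) →
    (∀ f₀ : K, ∃ f₁ : K, O.valuation (g₀ - f₁ ^ p) < O.valuation (g₀ - f₀ ^ p)) →
    (∀ hk : ∀ c : k, algebraMap k K c ∈ O, transcendenceDefect k O hk ≠ 0) →
    ¬ (∃ π : K, π ≠ 0 ∧ (∀ x : K, O.valuation x < 1 → O.valuation x ≤ O.valuation π) ∧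
      (∀ x : K, x ≠ 0 → ∃ n : ℕ, O.valuation π ^ n ≤ O.valuation x)) →
    ¬ (∃ (O₁ : ValuationSubring K), O ≤ O₁ ∧ O₁ ≠ ⊤ ∧ ∃ y : Fin 2 → K, (∀ i, y i ∈ O) ∧
      ∀ P : MvPolynomial (Fin 2) k, P ≠ 0 → O₁.valuation (MvPolynomial.aeval y P) = 1) →
    ¬ (PerfectField k ∧ ∃ x y : K, x ≠ 0 ∧ y ≠ 0 ∧ ∀ a b : ℕ, a < p → b < p → (a ≠ 0 ∨ b ≠ 0) →
      ∀ z : K, z ≠ 0 → O.valuation (x ^ a * y ^ b) ≠ O.valuation (z ^ p)) →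
    ¬ ((∃ x y : K, x ≠ 0 ∧ y ≠ 0 ∧ ∀ a b : ℕ, a < p → b < p → (a ≠ 0 ∨ b ≠ 0) →
        ∀ z : K, z ≠ 0 → O.valuation (x ^ a * y ^ b) ≠ O.valuation (z ^ p)) ∧
      ∃ r : ℕ, Module.finrank (Subfield.closure (Set.range (fun x : k => x ^ p))) k = p ^ r ∧
        Module.finrank (Subfield.closure (Set.range (fun x : IsLocalRing.ResidueField O => x ^ p))) (IsLocalRing.ResidueField O) = p ^ r) →
    ¬ ((∃ x y : K, x ≠ 0 ∧ y ≠ 0 ∧ ∀ a b : ℕ, a < p → b < p → (a ≠ 0 ∨ b ≠ 0) →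
        ∀ z : K, z ≠ 0 → O.valuation (x ^ a * y ^ b) ≠ O.valuation (z ^ p)) ∧
      ∃ k' : IntermediateField k K, FiniteDimensional k k' ∧
        (∃ (n : ℕ) (s : Fin n → K), AlgebraicIndependent k' s ∧ Algebra.IsSeparable (IntermediateField.adjoin k' (Set.range s)) K) ∧
        ∃ _ : Algebra k' (IsLocalRing.ResidueField O),
          (∀ (c : k') (h : algebraMap k' K c ∈ O),
            algebraMap k' (IsLocalRing.ResidueField O) c = IsLocalRing.residue O ⟨algebraMap k' K c, h⟩) ∧
          Algebra.IsSeparable k' (IsLocalRing.ResidueField O)) →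
    ¬ IsAlgClosed k →
    ¬ (∃ O₁ : ValuationSubring K, O ≤ O₁ ∧ O₁ ≠ O ∧ O₁ ≠ ⊤) →
    ∃ (A' : Subalgebra k K), A'.toSubring ≤ O.toSubring ∧ A ≤ A' ∧ A'.FG ∧
    ∃ (_ : IsRegularLocalRing (locAtCentre A'.toSubring O)) (c : Fin p → K), (∃ j : Fin p, (j : ℕ) ≠ 0 ∧ c j ≠ 0) ∧
    ((∃ (d m : ℕ) (hmd : m ≤ d) (t : Fin d → ↥(locAtCentre A'.toSubring O)) (a : Fin m → ℕ) (u : ↥(locAtCentre A'.toSubring O)), IsUnit u ∧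
    Ideal.span (Set.range t) = IsLocalRing.maximalIdeal ↥(locAtCentre A'.toSubring O) ∧
    ringKrullDim ↥(locAtCentre A'.toSubring O) = (d : WithBot ℕ∞) ∧ 0 < m ∧ (∀ i, ¬ p ∣ a i) ∧
    (∑ j : Fin p, c j ^ p * g₀ ^ (j : ℕ)) = (u : K) * ∏ i : Fin m, ((t (Fin.castLE hmd i) : ↥(locAtCentre A'.toSubring O)) : K) ^ (a i)) ∨
    (∃ u : ↥(locAtCentre A'.toSubring O), IsUnit u ∧ (∑ j : Fin p, c j ^ p * g₀ ^ (j : ℕ)) = (u : K) ∧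
    ∀ c' : ↥(locAtCentre A'.toSubring O), u - c' ^ p ∉ IsLocalRing.maximalIdeal ↥(locAtCentre A'.toSubring O)) ∨
    (∃ s c' : ↥(locAtCentre A'.toSubring O), (∑ j : Fin p, c j ^ p * g₀ ^ (j : ℕ)) = (s : K) ∧
    s - c' ^ p ∈ IsLocalRing.maximalIdeal ↥(locAtCentre A'.toSubring O) ∧
    s - c' ^ p ∉ IsLocalRing.maximalIdeal ↥(locAtCentre A'.toSubring O) ^ 2)))
  -- RESEARCH (OURS), X44c: `stub_cleanProp44` of Sketch rev 28–33, VERBATIM.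
  (h44c :
    ∀ (p : ℕ), p.Prime → ∀ (S : Scheme.{0}) [IsIntegral S] [IsNoetherian S],
      CharP S.functionField p → Scheme.IsRegular S → Scheme.IsExcellent S → topologicalKrullDim S = 3 →
      ∀ G₀ : S.functionField, (∀ s : S, CleanRegAt p (algebraMap (S.presheaf.stalk s) S.functionField) G₀) →
      ∀ I : S.IdealSheafData, I ≠ ⊥ →
      ∀ (X : Scheme.{0}) (ρ : X ⟶ S) [IsIntegral X] [IsNoetherian X] [IsDominant ρ],
        IsCleanRegularCentreBlowupSeq p ρ I G₀ →
        (∀ x : X, CleanRegAt p (algebraMap (X.presheaf.stalk x) X.functionField) (RatFn.functionFieldMap ρ G₀)) →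
        ∀ (J : X.IdealSheafData) (μ : ℕ), 1 ≤ μ →
          (∀ x ∈ J.support, 1 < Order.coheight x) → (∀ x, idealOrder J x ≤ μ) → (∃ x, idealOrder J x = μ) →
          ∃ (X' : Scheme.{0}) (π : X' ⟶ X) (_ : IsIntegral X') (_ : IsDominant π) (J' : X'.IdealSheafData),
            IsCleanPermissibleSeq p π J μ J' (RatFn.functionFieldMap ρ G₀) ∧ ∀ x, idealOrder J' x < μ)
  -- FRONTIER (rung-B PRICE): `stub_cleanModelsDimGEFour`, VERBATIM (`dim W ≥ 4`).
  (hGE4 :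
      ∀ p : ℕ, p.Prime → ∀ (k : Type) [Field k] [CharP k p] (W : AlgebraicGeometry.Scheme.{0})
      [AlgebraicGeometry.IsIntegral W] (f : W ⟶ AlgebraicGeometry.Spec (.of k)) (L : Type) [Field L] [Algebra
      W.functionField L], AlgebraicGeometry.IsSeparated f → AlgebraicGeometry.LocallyOfFiniteType f →
      AlgebraicGeometry.QuasiCompact f → Literature.AlgebraicGeometry.Resolution.Scheme.IsRegular W →
      IsPurelyInseparable W.functionField L → Module.finrank W.functionField L = p → ¬ topologicalKrullDim W ≤ 3 → ∃
      (V : AlgebraicGeometry.Scheme.{0}) (π : V ⟶ W) (_ : AlgebraicGeometry.IsIntegral V) (_ :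
      AlgebraicGeometry.IsDominant π), AlgebraicGeometry.IsProper π ∧
      Literature.AlgebraicGeometry.Resolution.IsBirational π ∧
      Literature.AlgebraicGeometry.Resolution.Scheme.IsRegular V ∧ (∀ v : V, (∃ (y : L) (g : W.functionField), y ∉
      Set.range (algebraMap W.functionField L) ∧ algebraMap W.functionField L g = y ^ p ∧ ((∃ (d m : ℕ) (hmd : m ≤ d)
      (t : Fin d → V.presheaf.stalk v) (a : Fin m → ℕ), Ideal.span (Set.range t) = IsLocalRing.maximalIdeal
      (V.presheaf.stalk v) ∧ ringKrullDim (V.presheaf.stalk v) = (d : WithBot ℕ∞) ∧ 0 < m ∧ (∀ i, ¬ p ∣ a i) ∧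
      Literature.AlgebraicGeometry.Motives.RatFn.functionFieldMap π g = ∏ i : Fin m, (algebraMap (V.presheaf.stalk v)
      V.functionField (t (Fin.castLE hmd i))) ^ (a i)) ∨ (∃ u₀ : V.presheaf.stalk v, IsUnit u₀ ∧
      Literature.AlgebraicGeometry.Motives.RatFn.functionFieldMap π g = algebraMap (V.presheaf.stalk v)
      V.functionField u₀ ∧ ((∀ c : V.presheaf.stalk v, u₀ - c ^ p ∉ IsLocalRing.maximalIdeal (V.presheaf.stalk v)) ∨
      (∃ c : V.presheaf.stalk v, u₀ - c ^ p ∈ IsLocalRing.maximalIdeal (V.presheaf.stalk v) ∧ u₀ - c ^ p ∉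
      IsLocalRing.maximalIdeal (V.presheaf.stalk v) ^ 2))))))) :
    Summit.ResolutionOfSingularities.ResolutionOfSingularities.Theses.RadicialJung.CleanModels :=
  cleanModels_of_inputs (CossartJannsenSaito2020Embedded.of_canonicalSequence_history h72)
    (CossartPiltant2019General.cossartPiltant2019' hG) h112 hBS hB h44c hGE4

end OfInputs

end Summit.ResolutionOfSingularities.ResolutionOfSingularities.Theorems.RadicialJung.CleanModels

end
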